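/-
Copyright: H21 programme, solo seat `solo-RiemannHypothesis-informed` (session 4).
-/
import Literature.NumberTheory.LFunctions.MontgomeryZeroSideProofs

/-!
# The zero-density constant as a definite number (solo-informed, T21)

First step of the effectivity programme for T9a–T20 (PLAN.md, design note): every constant of the
sampling/visibility package (`A₁`, `K(ψ)`, `c₀(ψ,η)`) descends from ONE existential, the local density
bound `Montgomery.exists_density_le` (`∃ A₁ > 0, ∀ t, ∑_n 1/(1+(t−γ_n)²) ≤ A₁ log(|t|+2)`). Here that
existential is replaced by a DEFINITE real number, the infimum of all admissible constants,
`zetaDensityConst := sInf {A ≥ 0 | ∀ t, ∑_n 1/(1+(t−γ_n)²) ≤ A log(|t|+2)}`, which is itself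
admissible (`tsum_density_le_zetaDensityConst`), positive (`zetaDensityConst_pos`), and bounded by
every admissible constant (`zetaDensityConst_le`) — so any future explicit admissible `A` (e.g. from
the named fact `zetaZeroCount_hasanalizade_shen_wong`) bounds it, and statements phrased with
`zetaDensityConst` become numerically effective without being re-proved.
-/

open Literature.NumberTheory.LFunctions

namespace Summit.RiemannHypothesis.RiemannHypothesis.Theorems

/-- The set of admissible local-density constants: `A ≥ 0` with
`∑_n 1/(1+(t−γ_n)²) ≤ A·log(|t|+2)` for every real `t` (`γ_n = zetaOrdinate n`). -/
def zetaDensitySet : Set ℝ :=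
  {A : ℝ | 0 ≤ A ∧ ∀ t : ℝ, ∑' n : ℕ, 1 / (1 + (t - zetaOrdinate n) ^ 2) ≤ A * Real.log (|t| + 2)}

/-- **The density constant**: the least admissible local-density constant. -/
noncomputable def zetaDensityConst : ℝ := sInf zetaDensitySet

/-- An explicit admissible constant is a member of `zetaDensitySet` (interface for future explicit
bounds, e.g. from `zetaZeroCount_hasanalizade_shen_wong`). -/
theorem mem_zetaDensitySet {A : ℝ} (hA : 0 ≤ A)
    (h : ∀ t : ℝ, ∑' n : ℕ, 1 / (1 + (t - zetaOrdinate n) ^ 2) ≤ A * Real.log (|t| + 2)) :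
    A ∈ zetaDensitySet := ⟨hA, h⟩

/-- `zetaDensitySet` is nonempty (the tree's `exists_density_le`). -/
theorem zetaDensitySet_nonempty : zetaDensitySet.Nonempty := by
  obtain ⟨A₁, hA₁, hD⟩ := Montgomery.exists_density_le
  exact ⟨A₁, hA₁.le, fun t ↦ (hD t).2⟩

/-- `zetaDensitySet` is bounded below by `0`. -/
theorem zetaDensitySet_bddBelow : BddBelow zetaDensitySet := ⟨0, fun _ hA ↦ hA.1⟩

/-- `0 ≤ zetaDensityConst`. -/
theorem zetaDensityConst_nonneg : 0 ≤ zetaDensityConst :=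
  le_csInf zetaDensitySet_nonempty fun _ hA ↦ hA.1

/-- Every admissible constant bounds the density constant. -/
theorem zetaDensityConst_le {A : ℝ} (hA : A ∈ zetaDensitySet) : zetaDensityConst ≤ A :=
  csInf_le zetaDensitySet_bddBelow hA

/-- **The density constant is admissible**: `∑_n 1/(1+(t−γ_n)²) ≤ zetaDensityConst · log(|t|+2)`
for every real `t`. -/
theorem tsum_density_le_zetaDensityConst (t : ℝ) :
    ∑' n : ℕ, 1 / (1 + (t - zetaOrdinate n) ^ 2) ≤ zetaDensityConst * Real.log (|t| + 2) := by
  have hlog : 0 < Real.log (|t| + 2) := Real.log_pos (by linarith [abs_nonneg t])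
  have h : (∑' n : ℕ, 1 / (1 + (t - zetaOrdinate n) ^ 2)) / Real.log (|t| + 2) ≤ zetaDensityConst :=
    le_csInf zetaDensitySet_nonempty fun A hA ↦ by rw [div_le_iff₀ hlog]; exact hA.2 t
  rwa [div_le_iff₀ hlog] at h

/-- `zetaDensityConst ∈ zetaDensitySet`. -/
theorem zetaDensityConst_mem : zetaDensityConst ∈ zetaDensitySet :=
  ⟨zetaDensityConst_nonneg, tsum_density_le_zetaDensityConst⟩

/-- `0 < zetaDensityConst` (at `t = γ₀ := zetaOrdinate 0` the series is `≥ 1`). -/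
theorem zetaDensityConst_pos : 0 < zetaDensityConst := by
  set t := zetaOrdinate 0
  have h := tsum_density_le_zetaDensityConst t
  have hterm : (1 : ℝ) ≤ ∑' n : ℕ, 1 / (1 + (t - zetaOrdinate n) ^ 2) := by
    have := (Montgomery.summable_firstWeight t).le_tsum 0 (fun j _ ↦ by positivity)
    simpa [t] using this
  have hlog : 0 < Real.log (|t| + 2) := Real.log_pos (by linarith [abs_nonneg t])
  by_contra hle
  push Not at hle
  have h0 : zetaDensityConst = 0 := le_antisymm hle zetaDensityConst_nonneg
  rw [h0, zero_mul] at h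
  linarith

/-- The tree's density lemma restated with the definite constant (drop-in replacement for
`Montgomery.exists_density_le` in T9a–T20). -/
theorem density_le_zetaDensityConst (t : ℝ) :
    (Summable fun n : ℕ ↦ 1 / (1 + (t - zetaOrdinate n) ^ 2)) ∧
      ∑' n : ℕ, 1 / (1 + (t - zetaOrdinate n) ^ 2) ≤ zetaDensityConst * Real.log (|t| + 2) :=
  ⟨Montgomery.summable_firstWeight t, tsum_density_le_zetaDensityConst t⟩

end Summit.RiemannHypothesis.RiemannHypothesis.Theorems
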